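/-
Copyright (c) 2026 the pub-hodgecm-mathlib formalisation cell (harness21).  Prover seat hodgecm-mathlib-K2E1-p14 (g0), Track B «K2-LIT» ENGINE E1, h413 =
`stmt-HodgeConjecture-24833`, route `HCCMUnconditional`, campaign «5Res» (b) «BL-2(χ,τ)» — X1_χ §2b (the CM BALL PACKAGE of the (χ,τ) system), dealer K2E1-plan (g7) (170)∕(186) «=».
-/
import Summits.HodgeConjecture.HodgeConjecture.Theorems.K2E1ChiEisensteinDataCMTwo                  -- ★ §2a (this seat): `exists_chi_constantTerm_data_cm_two`
import Summits.HodgeConjecture.HodgeConjecture.Theorems.K2E1ChiEisensteinMeromorphicExportsU2    -- ★ X1_χ §1 ED. 2 (this seat): `exists_chi_xSystem_byproducts'`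
import Summits.HodgeConjecture.HodgeConjecture.Theorems.K2E1ChiUniquenessHunqCMTwo               -- ★ (K2E1-p15): `hunq_chi_cm_two`
import Summits.HodgeConjecture.HodgeConjecture.Theorems.K2E1ChiEisensteinHeckeMatrixU2           -- ★ row 10: `integral_mul_eisensteinSeriesU_flatSectionU_eq_cm_two`
import Summits.HodgeConjecture.HodgeConjecture.Theorems.K2E1SphericalEisensteinSolvesXSystemU2Head -- ★ `quotFun_inv_smul_toAutomorphicQuotient` (the a.e. transport of the eigen-equation)
import Summits.HodgeConjecture.HodgeConjecture.Theorems.K2E1SphericalEisensteinMeromorphicExportsU2 -- ★ X1 (template): `hK1_cm_two_of`, `measurePreserving_rightShift_of_unfolding`, K2-defs1 (ii), closer₂ ED. 3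
import HarnessLib

/-!
# h413 ∕ Track B «K2-LIT», 5Res (b) — `K2E1ChiEisensteinBallPackageCMTwo` (X1_χ §2b): THE PER-BALL MEROMORPHIC PACKAGE OF THE (χ,τ) EISENSTEIN SERIES `E(f_z^φ)` ON `U(1,1)_{L∕L⁺}` —
# `v_X` (the continued `[E(f_z^φ)]`) and `cc` (the continued SCATTERING COORDINATES of `(ν𝓕)⁻¹·M(z)φ` in the basis `φ′_j`) MEROMORPHIC on `ball 0 (n+2)`, hypothesis-first on the ball's
# convolution data (binders) and ONE scalar-action letter `hS1`

Cell `pub/hodgecm-mathlib`, crux H413 = `stmt-HodgeConjecture-24833`; dealer K2E1-plan (g7) (170) «X1_χ §2 = the CM package at the M1 datum (χ, K_U, 1) in ★ currency», (186) «hypothesis-first on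
the convData COMPONENTS as binders «=»».  THEOREMS ONLY (no `def`, no `instance`, no `notation`, no named-fact hypothesis, no `sorry`); lane `--kind proof --supports stmt-HodgeConjecture-24833
--as helper` (count-neutral).

THE MATHEMATICS [BernsteinLapid2019, Thm 2.3, §4 Claims 1–5, p. 10, §7; MoeglinWaldspurger1995, IV.1.8–IV.1.9].  INPUT (binders): the ball's convolution data `(I, i₀, η, a, κ, T)` with EXACTLY
the clauses of ★ `exists_convData_cm_two` ∕ ★ `exists_chi_convData_cm_two` that are consumed (`hη hconv hh1 hcov hκ hcmp hι hT hpack`), so that either ★ supplier instantiates them without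
re-proof; the section data of ★ §2a (`φ ∈ V(χ,K′,ω)`, the `χʷ`-family `φ′_j`, the coordinates `bX` with `hbX`); and ONE LETTER **`hS1`**: the self-convolutions `h_i = S_{η_i}η_i` act on
the flat sections `f_z^φ` (`1 < Re z`) by their SPHERICAL TRANSFORMS `ĥ_i(z) = ∫ h_i·H^z dν_G` — TRUE at the M1 datum (`χ_∞ = 1`, `K′ = K_U`, `ω = 1`) for the arch-only ★ test functions
(ruling (170)); in general the eigenvalue is the `(χ_∞,ω)`-spherical transform and the generic-`ŝ` editions apply.  OUTPUT: the co-discrete dense open `U ⊆ ball 0 (n+2)`, `v_X : ℂ → 𝓗_k(𝔛)`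
and `cc : ℂ → ℂ^{ι′}` HOLOMORPHIC on `U` and MEROMORPHIC on the ball, with on `U` the eigen-equations `T_i v_X(z) = ĥ_i(z)·v_X(z)`, the α-SYSTEM `cnst_N(ι v_X(z)) = α₁(z) + L(z)(cc z)`
(`α₁ =ᵐ zFun f_z^φ`, `L(z) = Σ_j proj_j.smulRight col_j(z)`, `col_j =ᵐ zFun f^{φ′_j}_{1−z}`) and UNIQUENESS, and on `U ∩ {1 < Re}` the Godement agreement `v_X(z) =ᵐ [E(f_z^φ)]`,
`cc z = bX z` — i.e. `cc` IS the meromorphic continuation of the scattering coordinates `(ν𝓕)⁻¹·M(z)φ` (C3's input).  PROOF = ★ X1 `exists_ball_package_cm_two` line by line: K1 ★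
`hK1_cm_two_of` at the levels `(a, κ_i a)`; ★ §2a for `α₁, col, L, eX, hα₁d, hL, hLinj, hsolC`; `hsolT` from `hS1` through ★ row 10 `integral_mul_eisensteinSeriesU_flatSectionU_eq_cm_two`,
`E(c•f) = c•E(f)` and the a.e. transport of ★ `shiftOperatorX_toHX_eisensteinSeriesU_eq_smul_cm_two`; `hδL` (columns `=ᵐ zFun φ′_j·HZ^{1−z}`, ★ `exists_ae_norm_deltaShift_le_of_ae_eq_mul_cpow`,
finite sums); ★ `hunq_chi_cm_two` (`Q := 0`); then ★ `exists_chi_xSystem_byproducts'` (`σ₀ = 1`).  NOT HERE (honest): the scalar pieces (R4) `E(f_z^φ)(g)` with their germs (§2c).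
HONEST LABEL: HC_CM is proved only modulo the 7 printed citations (2 remaining named inputs: hLiu418 = `stmt-HodgeConjecture-24832`, h413 = `stmt-HodgeConjecture-24833`) until rung 0
closes; count-neutral helper, closes no socket; the letter `hS1` is NOT proved here.

## References
* [BernsteinLapid2019] J. Bernstein, E. Lapid, *On the meromorphic continuation of Eisenstein series*, J. Amer. Math. Soc. 37 (2024) (arXiv:1911.02342), Thm 2.3, §4, §7.
* [MoeglinWaldspurger1995] C. Mœglin, J.-L. Waldspurger, *Spectral Decomposition and Eisenstein Series* (1995), II.1.7, IV.1.8–IV.1.9.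
-/

set_option autoImplicit false
-- the mandated namespace repeats `HodgeConjecture.HodgeConjecture`, as in every `Theorems/*.lean` of this sub-problem
set_option linter.dupNamespace false

noncomputable section

open MeasureTheory Measure Filter Topology Set NumberField IsDedekindDomain
open scoped NNReal ENNReal Classical ComplexConjugate
open Literature.MeasureTheory.Group Literature.NumberTheory Literature.NumberTheory.Automorphic Literature.NumberTheory.Automorphic.UnitaryGroup AdelicGroupData
open Literature.NumberTheory.GaloisRepresentations (HeckeCharacter)
open Summit.HodgeConjecture.HodgeConjecture.Cruxes.H413.K2E1BorelEisensteinU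
open Summit.HodgeConjecture.HodgeConjecture.Cruxes.H413.K2E1BLBorelSpacesU2Defs
open Summit.HodgeConjecture.HodgeConjecture.Cruxes.H413.K2E1BLBorelOperatorsU2Defs
open Summit.HodgeConjecture.HodgeConjecture.Cruxes.H413.K2E1CharacterEisensteinU2Defs
open Summit.HodgeConjecture.HodgeConjecture.Cruxes.H413.K2E1ChiSectionSpaceU2Defs
open Summit.HodgeConjecture.HodgeConjecture.Cruxes.H413.K2E1ChiEisensteinDataCMTwo (exists_chi_constantTerm_data_cm_two)
open Summit.HodgeConjecture.HodgeConjecture.Cruxes.H413.K2E1ChiEisensteinMeromorphicExportsU2 (exists_chi_xSystem_byproducts')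
open Summit.HodgeConjecture.HodgeConjecture.Cruxes.H413.K2E1ChiUniquenessHunqCMTwo (hunq_chi_cm_two)
open Summit.HodgeConjecture.HodgeConjecture.Cruxes.H413.K2E1ChiEisensteinHeckeMatrixU2 (integral_mul_eisensteinSeriesU_flatSectionU_eq_cm_two)
open Summit.HodgeConjecture.HodgeConjecture.Cruxes.H413.K2E1ChiEisensteinSolvesXSystemU2 (eisensteinSeriesU_flatSectionU_quotientSubgroup_mul_of_isChiSection)
open Summit.HodgeConjecture.HodgeConjecture.Cruxes.H413.K2E1SphericalEisensteinSolvesXSystemU2 (quotFun_inv_smul_toAutomorphicQuotient)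
open Summit.HodgeConjecture.HodgeConjecture.Cruxes.H413.K2E1ChiFlatSectionHNHolomorphicU2 (norm_zFun_le zFun_flatSectionU)
open Summit.HodgeConjecture.HodgeConjecture.Cruxes.H413.K2E1ChiConstantTermColumnsIndependentU2 (coeFn_sum_smul_ae_eq)
open Summit.HodgeConjecture.HodgeConjecture.Cruxes.H413.K2E1ChiHomogeneousL2U2 (exists_ae_norm_deltaShift_le_of_ae_eq_mul_cpow)
open Summit.HodgeConjecture.HodgeConjecture.Cruxes.H413.K2E1BLHeckeOperatorHXU2 (convX_congr_ae)
open Summit.HodgeConjecture.HodgeConjecture.Cruxes.H413.K2E1BLHeckeOperatorHXU2Op (ae_withDensity_weightX_iff)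
open Summit.HodgeConjecture.HodgeConjecture.Cruxes.H413.K2E1BLIotaClosedEmbeddingU2 (iotaBound_cm isFiniteMeasure_weightedTruncMeasure_cm)
open Summit.HodgeConjecture.HodgeConjecture.Cruxes.H413.K2E1SphericalEisensteinMeromorphicSuppliersU2 (measure_setOf_lt_ne_top_cm)
open Summit.HodgeConjecture.HodgeConjecture.Cruxes.H413.K2E1BLQuotientMeasureU (measurePreserving_rightShift_of_unfolding)
open Summit.HodgeConjecture.HodgeConjecture.Cruxes.H413.K2E1IntertwinedSectionInvariance (map_conj_toAdelic_eq_self_two)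

namespace Summit.HodgeConjecture.HodgeConjecture.Cruxes.H413.K2E1ChiEisensteinBallPackageCMTwo

variable (L : Type) [Field L] [NumberField L] [IsCMField L]
  [MeasurableSpace (quasiSplit (↥(maximalRealSubfield L)) L (IsCMField.complexConj L) 2).Adelic] [BorelSpace (quasiSplit (↥(maximalRealSubfield L)) L (IsCMField.complexConj L) 2).Adelic]

/-- **X1_χ §2b — THE PER-BALL MEROMORPHIC PACKAGE OF `E(f_z^φ)`** (module docstring): on the ball's convolution data (binders, ★ convData clauses) and the scalar-action letter `hS1`,
the co-discrete `U`, `v_X` and the scattering coordinates `cc` holomorphic on `U` ∕ meromorphic on `ball 0 (n+2)`, the eigen-equations, the α-system with uniqueness on `U`, and the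
Godement agreement `v_X =ᵐ [E(f_z^φ)]`, `cc = bX` on `U ∩ {1 < Re}`. [cite: BernsteinLapid2019, Thm 2.3, §4 Claims 1–5, p. 10, §7] [cite: MoeglinWaldspurger1995, IV.1.8–IV.1.9] -/
theorem exists_chi_ball_package_cm_two_of_letters
    (μ : Measure (quasiSplit (↥(maximalRealSubfield L)) L (IsCMField.complexConj L) 2).automorphicQuotient) [(quasiSplit (↥(maximalRealSubfield L)) L (IsCMField.complexConj L) 2).IsAutomorphicMeasure μ]
    (νG : Measure (quasiSplit (↥(maximalRealSubfield L)) L (IsCMField.complexConj L) 2).Adelic) [νG.IsHaarMeasure] [νG.IsInvInvariant] [SFinite νG]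
    (ν : Measure ↥(adelicUnipotent (↥(maximalRealSubfield L)) L (IsCMField.complexConj L) 2)) [ν.IsHaarMeasure] [ν.IsMulRightInvariant] [ν.IsInvInvariant]
    {𝓕 : Set ↥(adelicUnipotent (↥(maximalRealSubfield L)) L (IsCMField.complexConj L) 2)}
    (h𝓕N : IsFundamentalDomain ↥(rationalUnipotent (↥(maximalRealSubfield L)) L (IsCMField.complexConj L) 2) 𝓕 ν) (h𝓕c : IsCompact (closure 𝓕)) (h𝓕₀ : ν 𝓕 ≠ 0)
    {β : (quasiSplit (↥(maximalRealSubfield L)) L (IsCMField.complexConj L) 2).Adelic → ℝ≥0∞}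
    (hβ : IsCoveringWeight ↥((arithmeticBorel (↥(maximalRealSubfield L)) L (IsCMField.complexConj L) 2).map (quasiSplit (↥(maximalRealSubfield L)) L (IsCMField.complexConj L) 2).arithmeticSubgroup.subtype) β)
    {μZ : Measure (borelQuotient (↥(maximalRealSubfield L)) L (IsCMField.complexConj L) 2)} [SFinite μZ]
    (hμZ : ∀ f : borelQuotient (↥(maximalRealSubfield L)) L (IsCMField.complexConj L) 2 → ℝ≥0∞, Measurable f → ∫⁻ z, f z ∂μZ = ∫⁻ g, β g * f (toBorelQuotient (↥(maximalRealSubfield L)) L (IsCMField.complexConj L) 2 g) ∂νG)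
    (n : ℕ)
    -- ── the ball's CONVOLUTION DATA as binders (★ `exists_convData_cm_two` ∕ ★ `exists_chi_convData_cm_two` clauses, verbatim) ──
    {I : Type} [Fintype I] (i₀ : I) (η : I → GL (Fin 2) (AdeleRing (𝓞 L) L) → ℝ) {a : ℝ≥0} (ha : 0 < a) (κ : I → ℝ≥0)
    (T : I → HX (↥(maximalRealSubfield L)) L (IsCMField.complexConj L) 2 (n + 3) μ →L[ℂ] HX (↥(maximalRealSubfield L)) L (IsCMField.complexConj L) 2 (n + 3) μ)
    (hη : ∀ i, IsTestFunctionGL 2 L (η i))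
    (hconv : ∀ i, Continuous ((fun (i : I) (y : (quasiSplit (↥(maximalRealSubfield L)) L (IsCMField.complexConj L) 2).Adelic) => orbitalSmoothing νG (fun x : (quasiSplit (↥(maximalRealSubfield L)) L (IsCMField.complexConj L) 2).Adelic => ((η i (adelicVal (↥(maximalRealSubfield L)) L (IsCMField.complexConj L) 2 ((StdForm.antidiagonal 2).over L) x) : ℝ) : ℂ)) (fun x : (quasiSplit (↥(maximalRealSubfield L)) L (IsCMField.complexConj L) 2).Adelic => ((η i (adelicVal (↥(maximalRealSubfield L)) L (IsCMField.complexConj L) 2 ((StdForm.antidiagonal 2).over L) x) : ℝ) : ℂ)) y) i) ∧ HasCompactSupport ((fun (i : I) (y : (quasiSplit (↥(maximalRealSubfield L)) L (IsCMField.complexConj L) 2).Adelic) => orbitalSmoothing νG (fun x : (quasiSplit (↥(maximalRealSubfield L)) L (IsCMField.complexConj L) 2).Adelic => ((η i (adelicVal (↥(maximalRealSubfield L)) L (IsCMField.complexConj L) 2 ((StdForm.antidiagonal 2).over L) x) : ℝ) : ℂ)) (fun x : (quasiSplit (↥(maximalRealSubfield L)) L (IsCMField.complexConj L) 2).Adelic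 => ((η i (adelicVal (↥(maximalRealSubfield L)) L (IsCMField.complexConj L) 2 ((StdForm.antidiagonal 2).over L) x) : ℝ) : ℂ)) y) i) ∧ (∀ g, (fun (i : I) (y : (quasiSplit (↥(maximalRealSubfield L)) L (IsCMField.complexConj L) 2).Adelic) => orbitalSmoothing νG (fun x : (quasiSplit (↥(maximalRealSubfield L)) L (IsCMField.complexConj L) 2).Adelic => ((η i (adelicVal (↥(maximalRealSubfield L)) L (IsCMField.complexConj L) 2 ((StdForm.antidiagonal 2).over L) x) : ℝ) : ℂ)) (fun x : (quasiSplit (↥(maximalRealSubfield L)) L (IsCMField.complexConj L) 2).Adelic => ((η i (adelicVal (↥(maximalRealSubfield L)) L (IsCMField.complexConj L) 2 ((StdForm.antidiagonal 2).over L) x) : ℝ) : ℂ)) y) i g⁻¹ = (fun (i : I) (y : (quasiSplit (↥(maximalRealSubfield L)) L (IsCMField.complexConj L) 2).Adelic) => orbitalSmoothing νG (fun x : (quasiSplit (↥(maximalRealSubfield L)) L (IsCMField.complexConj L) 2).Adelic => ((η i (adelicVal (↥(maximalRealSubfield L)) L (IsCMField.complexConj L) 2 ((StdForm.antidiagonal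 2).over L) x) : ℝ) : ℂ)) (fun x : (quasiSplit (↥(maximalRealSubfield L)) L (IsCMField.complexConj L) 2).Adelic => ((η i (adelicVal (↥(maximalRealSubfield L)) L (IsCMField.complexConj L) 2 ((StdForm.antidiagonal 2).over L) x) : ℝ) : ℂ)) y) i g) ∧ (∀ g, conj ((fun (i : I) (y : (quasiSplit (↥(maximalRealSubfield L)) L (IsCMField.complexConj L) 2).Adelic) => orbitalSmoothing νG (fun x : (quasiSplit (↥(maximalRealSubfield L)) L (IsCMField.complexConj L) 2).Adelic => ((η i (adelicVal (↥(maximalRealSubfield L)) L (IsCMField.complexConj L) 2 ((StdForm.antidiagonal 2).over L) x) : ℝ) : ℂ)) (fun x : (quasiSplit (↥(maximalRealSubfield L)) L (IsCMField.complexConj L) 2).Adelic => ((η i (adelicVal (↥(maximalRealSubfield L)) L (IsCMField.complexConj L) 2 ((StdForm.antidiagonal 2).over L) x) : ℝ) : ℂ)) y) i g) = (fun (i : I) (y : (quasiSplit (↥(maximalRealSubfield L)) L (IsCMField.complexConj L) 2).Adelic) => orbitalSmoothing νG (fun x : (quasiSplit (↥(maximalRealSubfield L)) L (IsCMField.complexConj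 L) 2).Adelic => ((η i (adelicVal (↥(maximalRealSubfield L)) L (IsCMField.complexConj L) 2 ((StdForm.antidiagonal 2).over L) x) : ℝ) : ℂ)) (fun x : (quasiSplit (↥(maximalRealSubfield L)) L (IsCMField.complexConj L) 2).Adelic => ((η i (adelicVal (↥(maximalRealSubfield L)) L (IsCMField.complexConj L) 2 ((StdForm.antidiagonal 2).over L) x) : ℝ) : ℂ)) y) i g) ∧ (∀ g, 0 ≤ ((fun (i : I) (y : (quasiSplit (↥(maximalRealSubfield L)) L (IsCMField.complexConj L) 2).Adelic) => orbitalSmoothing νG (fun x : (quasiSplit (↥(maximalRealSubfield L)) L (IsCMField.complexConj L) 2).Adelic => ((η i (adelicVal (↥(maximalRealSubfield L)) L (IsCMField.complexConj L) 2 ((StdForm.antidiagonal 2).over L) x) : ℝ) : ℂ)) (fun x : (quasiSplit (↥(maximalRealSubfield L)) L (IsCMField.complexConj L) 2).Adelic => ((η i (adelicVal (↥(maximalRealSubfield L)) L (IsCMField.complexConj L) 2 ((StdForm.antidiagonal 2).over L) x) : ℝ) : ℂ)) y) i g).re))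
    (hh1 : (fun (i : I) (y : (quasiSplit (↥(maximalRealSubfield L)) L (IsCMField.complexConj L) 2).Adelic) => orbitalSmoothing νG (fun x : (quasiSplit (↥(maximalRealSubfield L)) L (IsCMField.complexConj L) 2).Adelic => ((η i (adelicVal (↥(maximalRealSubfield L)) L (IsCMField.complexConj L) 2 ((StdForm.antidiagonal 2).over L) x) : ℝ) : ℂ)) (fun x : (quasiSplit (↥(maximalRealSubfield L)) L (IsCMField.complexConj L) 2).Adelic => ((η i (adelicVal (↥(maximalRealSubfield L)) L (IsCMField.complexConj L) 2 ((StdForm.antidiagonal 2).over L) x) : ℝ) : ℂ)) y) i₀ 1 ≠ 0)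
    (hcov : ∀ z ∈ Metric.ball (0 : ℂ) (n + 2), ∃ i, (∫ x, (fun (i : I) (y : (quasiSplit (↥(maximalRealSubfield L)) L (IsCMField.complexConj L) 2).Adelic) => orbitalSmoothing νG (fun x : (quasiSplit (↥(maximalRealSubfield L)) L (IsCMField.complexConj L) 2).Adelic => ((η i (adelicVal (↥(maximalRealSubfield L)) L (IsCMField.complexConj L) 2 ((StdForm.antidiagonal 2).over L) x) : ℝ) : ℂ)) (fun x : (quasiSplit (↥(maximalRealSubfield L)) L (IsCMField.complexConj L) 2).Adelic => ((η i (adelicVal (↥(maximalRealSubfield L)) L (IsCMField.complexConj L) 2 ((StdForm.antidiagonal 2).over L) x) : ℝ) : ℂ)) y) i x * (((borelHeight x : ℝ≥0) : ℝ) : ℂ) ^ z ∂νG) ≠ 0)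
    (hκ : ∀ i, 1 ≤ κ i ∧ a ≤ κ i * a)
    (hcmp : ∀ i, ∀ z : borelQuotient (↥(maximalRealSubfield L)) L (IsCMField.complexConj L) 2, ∀ y ∈ tsupport ((fun (i : I) (y : (quasiSplit (↥(maximalRealSubfield L)) L (IsCMField.complexConj L) 2).Adelic) => orbitalSmoothing νG (fun x : (quasiSplit (↥(maximalRealSubfield L)) L (IsCMField.complexConj L) 2).Adelic => ((η i (adelicVal (↥(maximalRealSubfield L)) L (IsCMField.complexConj L) 2 ((StdForm.antidiagonal 2).over L) x) : ℝ) : ℂ)) (fun x : (quasiSplit (↥(maximalRealSubfield L)) L (IsCMField.complexConj L) 2).Adelic => ((η i (adelicVal (↥(maximalRealSubfield L)) L (IsCMField.complexConj L) 2 ((StdForm.antidiagonal 2).over L) x) : ℝ) : ℂ)) y) i),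
      borelQuotHeight (↥(maximalRealSubfield L)) L (IsCMField.complexConj L) 2 z ≤ κ i * borelQuotHeight (↥(maximalRealSubfield L)) L (IsCMField.complexConj L) 2 (rightShift (↥(maximalRealSubfield L)) L (IsCMField.complexConj L) 2 y z))
    (hι : ∀ i, ∃ hpos : 0 < κ i * a, Function.Injective (iota (iotaBound_cm L μ νG hβ hμZ hpos (n + 3))) ∧
      IsClosed ((LinearMap.range (iota (iotaBound_cm L μ νG hβ hμZ hpos (n + 3))).toLinearMap : Submodule ℂ (HN (↥(maximalRealSubfield L)) L (IsCMField.complexConj L) 2 (n + 3) (κ i * a) μZ)) : Set (HN (↥(maximalRealSubfield L)) L (IsCMField.complexConj L) 2 (n + 3) (κ i * a) μZ)))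
    (hT : ∀ i, ∀ u : HX (↥(maximalRealSubfield L)) L (IsCMField.complexConj L) 2 (n + 3) μ, ((T i u : HX (↥(maximalRealSubfield L)) L (IsCMField.complexConj L) 2 (n + 3) μ) : (quasiSplit (↥(maximalRealSubfield L)) L (IsCMField.complexConj L) 2).automorphicQuotient → ℂ) =ᵐ[(μ.withDensity fun x => (((supHeight (↥(maximalRealSubfield L)) L (IsCMField.complexConj L) 2 x)⁻¹ ^ (2 * (n + 3)) : ℝ≥0) : ℝ≥0∞))] fun ξ => ∫ y, (fun (i : I) (y : (quasiSplit (↥(maximalRealSubfield L)) L (IsCMField.complexConj L) 2).Adelic) => orbitalSmoothing νG (fun x : (quasiSplit (↥(maximalRealSubfield L)) L (IsCMField.complexConj L) 2).Adelic => ((η i (adelicVal (↥(maximalRealSubfield L)) L (IsCMField.complexConj L) 2 ((StdForm.antidiagonal 2).over L) x) : ℝ) : ℂ)) (fun x : (quasiSplit (↥(maximalRealSubfield L)) L (IsCMField.complexConj L) 2).Adelic => ((η i (adelicVal (↥(maximalRealSubfield L)) L (IsCMField.complexConj L) 2 ((StdForm.antidiagonal 2).over L) x) : ℝ) : ℂ))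 y) i y * (u : (quasiSplit (↥(maximalRealSubfield L)) L (IsCMField.complexConj L) 2).automorphicQuotient → ℂ) (y⁻¹ • ξ) ∂νG)
    (hpack : ∀ i, ∃ hs : ShiftBound (↥(maximalRealSubfield L)) L (IsCMField.complexConj L) 2 (n + 3) a (κ i * a) νG μZ ((fun (i : I) (y : (quasiSplit (↥(maximalRealSubfield L)) L (IsCMField.complexConj L) 2).Adelic) => orbitalSmoothing νG (fun x : (quasiSplit (↥(maximalRealSubfield L)) L (IsCMField.complexConj L) 2).Adelic => ((η i (adelicVal (↥(maximalRealSubfield L)) L (IsCMField.complexConj L) 2 ((StdForm.antidiagonal 2).over L) x) : ℝ) : ℂ)) (fun x : (quasiSplit (↥(maximalRealSubfield L)) L (IsCMField.complexConj L) 2).Adelic => ((η i (adelicVal (↥(maximalRealSubfield L)) L (IsCMField.complexConj L) 2 ((StdForm.antidiagonal 2).over L) x) : ℝ) : ℂ)) y) i),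
      ∀ h01 : a ≤ κ i * a, deltaShift hs ∘L iota (iotaBound_cm L μ νG hβ hμZ ha (n + 3)) = restrHN (↥(maximalRealSubfield L)) L (IsCMField.complexConj L) 2 (n + 3) h01 μZ ∘L iota (iotaBound_cm L μ νG hβ hμZ ha (n + 3)) ∘L T i)
    -- ── the section data (as ★ §2a) ──
    {χ : HeckeCharacter L} {K' : Subgroup (quasiSplit (↥(maximalRealSubfield L)) L (IsCMField.complexConj L) 2).Adelic} {ω : ↥K' → ℂ} {φ : (quasiSplit (↥(maximalRealSubfield L)) L (IsCMField.complexConj L) 2).Adelic → ℂ} (hφV : φ ∈ chiSectionSpace χ K' ω) (hφc : Continuous φ) {Mφ : ℝ} (hφM : ∀ x, ‖φ x‖ ≤ Mφ)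
    {ι' : Type} [Fintype ι'] {φ' : ι' → (quasiSplit (↥(maximalRealSubfield L)) L (IsCMField.complexConj L) 2).Adelic → ℂ} (hli : LinearIndependent ℂ φ') (hφ'c : ∀ j, Continuous (φ' j))
    (hφ'χ : ∀ j, IsChiSection (reflectChar (IsCMField.complexConj L) χ) (φ' j)) {Mb : ℝ} (hφ'M : ∀ j x, ‖φ' j x‖ ≤ Mb)
    (bX : ℂ → ι' → ℂ)
    (hbX : ∀ z ∈ Metric.ball (0 : ℂ) (n + 2), 1 < z.re → (∑ j, bX z j • φ' j) = ((((ν 𝓕).toReal⁻¹ : ℝ)) : ℂ) • (fun g : (quasiSplit (↥(maximalRealSubfield L)) L (IsCMField.complexConj L) 2).Adelic => (∫ v : ↥(adelicUnipotent (↥(maximalRealSubfield L)) L (IsCMField.complexConj L) 2), flatSectionU φ z ((quasiSplit (↥(maximalRealSubfield L)) L (IsCMField.complexConj L) 2).toAdelic (weylLongU ((IsCMField.complexConj L : L ≃ₐ[↥(maximalRealSubfield L)] L) : L →+* L) (rfl : (StdForm.antidiagonal 2).over L = (StdForm.antidiagonal 2).over L)) * ((v : (quasiSplit (↥(maximalRealSubfield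 L)) L (IsCMField.complexConj L) 2).Adelic) * g)) ∂ν) * (((borelHeight g : ℝ) : ℂ) ^ (z - 1))))
    -- ── THE LETTER: the `h_i` act on the flat sections `f_z^φ` by their spherical transforms (M1 datum; ruling (170)) ──
    (hS1 : ∀ i (z : ℂ), 1 < z.re → ∀ x : (quasiSplit (↥(maximalRealSubfield L)) L (IsCMField.complexConj L) 2).Adelic, (∫ y, (fun (i : I) (y : (quasiSplit (↥(maximalRealSubfield L)) L (IsCMField.complexConj L) 2).Adelic) => orbitalSmoothing νG (fun x : (quasiSplit (↥(maximalRealSubfield L)) L (IsCMField.complexConj L) 2).Adelic => ((η i (adelicVal (↥(maximalRealSubfield L)) L (IsCMField.complexConj L) 2 ((StdForm.antidiagonal 2).over L) x) : ℝ) : ℂ)) (fun x : (quasiSplit (↥(maximalRealSubfield L)) L (IsCMField.complexConj L) 2).Adelic => ((η i (adelicVal (↥(maximalRealSubfield L)) L (IsCMField.complexConj L) 2 ((StdForm.antidiagonal 2).over L) x) : ℝ) : ℂ)) y) i y * flatSectionU φ z (x * y) ∂νG) = (∫ x, (fun (i : I) (y : (quasiSplit (↥(maximalRealSubfield L)) L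 (IsCMField.complexConj L) 2).Adelic) => orbitalSmoothing νG (fun x : (quasiSplit (↥(maximalRealSubfield L)) L (IsCMField.complexConj L) 2).Adelic => ((η i (adelicVal (↥(maximalRealSubfield L)) L (IsCMField.complexConj L) 2 ((StdForm.antidiagonal 2).over L) x) : ℝ) : ℂ)) (fun x : (quasiSplit (↥(maximalRealSubfield L)) L (IsCMField.complexConj L) 2).Adelic => ((η i (adelicVal (↥(maximalRealSubfield L)) L (IsCMField.complexConj L) 2 ((StdForm.antidiagonal 2).over L) x) : ℝ) : ℂ)) y) i x * (((borelHeight x : ℝ≥0) : ℝ) : ℂ) ^ z ∂νG) * flatSectionU φ z x) :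
    ∃ (U : Set ℂ) (vX : ℂ → HX (↥(maximalRealSubfield L)) L (IsCMField.complexConj L) 2 (n + 3) μ) (cc : ℂ → ι' → ℂ) (hb : IotaBound (↥(maximalRealSubfield L)) L (IsCMField.complexConj L) 2 (n + 3) a μ μZ) (α₁ : ℂ → HN (↥(maximalRealSubfield L)) L (IsCMField.complexConj L) 2 (n + 3) a μZ) (col : ι' → ℂ → HN (↥(maximalRealSubfield L)) L (IsCMField.complexConj L) 2 (n + 3) a μZ),
      IsOpen U ∧ U ⊆ Metric.ball (0 : ℂ) (n + 2) ∧ Metric.ball (0 : ℂ) (n + 2) ⊆ closure U ∧ (∀ z₀ ∈ Metric.ball (0 : ℂ) (n + 2), ∀ᶠ s in 𝓝[≠] z₀, s ∈ U) ∧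
      DifferentiableOn ℂ vX U ∧ MeromorphicOn vX (Metric.ball (0 : ℂ) (n + 2)) ∧ DifferentiableOn ℂ cc U ∧ MeromorphicOn cc (Metric.ball (0 : ℂ) (n + 2)) ∧
      (∀ z ∈ Metric.ball (0 : ℂ) (n + 2), (α₁ z : borelQuotient (↥(maximalRealSubfield L)) L (IsCMField.complexConj L) 2 → ℂ) =ᵐ[weightedTruncMeasure (↥(maximalRealSubfield L)) L (IsCMField.complexConj L) 2 (n + 3) a μZ] zFun (↥(maximalRealSubfield L)) L (IsCMField.complexConj L) 2 (flatSectionU φ z)) ∧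
      (∀ j, ∀ z ∈ Metric.ball (0 : ℂ) (n + 2), (col j z : borelQuotient (↥(maximalRealSubfield L)) L (IsCMField.complexConj L) 2 → ℂ) =ᵐ[weightedTruncMeasure (↥(maximalRealSubfield L)) L (IsCMField.complexConj L) 2 (n + 3) a μZ] zFun (↥(maximalRealSubfield L)) L (IsCMField.complexConj L) 2 (flatSectionU (φ' j) (1 - z))) ∧
      (∀ z ∈ U, (∀ i, T i (vX z) = (∫ x, (fun (i : I) (y : (quasiSplit (↥(maximalRealSubfield L)) L (IsCMField.complexConj L) 2).Adelic) => orbitalSmoothing νG (fun x : (quasiSplit (↥(maximalRealSubfield L)) L (IsCMField.complexConj L) 2).Adelic => ((η i (adelicVal (↥(maximalRealSubfield L)) L (IsCMField.complexConj L) 2 ((StdForm.antidiagonal 2).over L) x) : ℝ) : ℂ)) (fun x : (quasiSplit (↥(maximalRealSubfield L)) L (IsCMField.complexConj L) 2).Adelic => ((η i (adelicVal (↥(maximalRealSubfield L)) L (IsCMField.complexConj L) 2 ((StdForm.antidiagonal 2).over L) x) : ℝ) : ℂ)) y) i x * (((borelHeight x : ℝ≥0) : ℝ) : ℂ) ^ z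 ∂νG) • vX z) ∧ cnstN (↥(maximalRealSubfield L)) L (IsCMField.complexConj L) 2 (n + 3) a μZ (iota hb (vX z)) = (1 : ℂ) • α₁ z + (∑ j, (ContinuousLinearMap.proj (R := ℂ) (φ := fun _ : ι' => ℂ) j).smulRight (col j z) : (ι' → ℂ) →L[ℂ] HN (↥(maximalRealSubfield L)) L (IsCMField.complexConj L) 2 (n + 3) a μZ) (cc z)) ∧
      (∀ z ∈ U, ∀ (ψ : HX (↥(maximalRealSubfield L)) L (IsCMField.complexConj L) 2 (n + 3) μ) (b : ι' → ℂ), (∀ i, T i ψ = (∫ x, (fun (i : I) (y : (quasiSplit (↥(maximalRealSubfield L)) L (IsCMField.complexConj L) 2).Adelic) => orbitalSmoothing νG (fun x : (quasiSplit (↥(maximalRealSubfield L)) L (IsCMField.complexConj L) 2).Adelic => ((η i (adelicVal (↥(maximalRealSubfield L)) L (IsCMField.complexConj L) 2 ((StdForm.antidiagonal 2).over L) x) : ℝ) : ℂ)) (fun x : (quasiSplit (↥(maximalRealSubfield L)) L (IsCMField.complexConj L) 2).Adelic => ((η i (adelicVal (↥(maximalRealSubfield L)) L (IsCMField.complexConj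 L) 2 ((StdForm.antidiagonal 2).over L) x) : ℝ) : ℂ)) y) i x * (((borelHeight x : ℝ≥0) : ℝ) : ℂ) ^ z ∂νG) • ψ) →
        cnstN (↥(maximalRealSubfield L)) L (IsCMField.complexConj L) 2 (n + 3) a μZ (iota hb ψ) = (1 : ℂ) • α₁ z + (∑ j, (ContinuousLinearMap.proj (R := ℂ) (φ := fun _ : ι' => ℂ) j).smulRight (col j z) : (ι' → ℂ) →L[ℂ] HN (↥(maximalRealSubfield L)) L (IsCMField.complexConj L) 2 (n + 3) a μZ) b → ψ = vX z ∧ b = cc z) ∧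
      (∀ z ∈ U, 1 < z.re → ((vX z : HX (↥(maximalRealSubfield L)) L (IsCMField.complexConj L) 2 (n + 3) μ) : (quasiSplit (↥(maximalRealSubfield L)) L (IsCMField.complexConj L) 2).automorphicQuotient → ℂ) =ᵐ[(μ.withDensity fun x => (((supHeight (↥(maximalRealSubfield L)) L (IsCMField.complexConj L) 2 x)⁻¹ ^ (2 * (n + 3)) : ℝ≥0) : ℝ≥0∞))] (quasiSplit (↥(maximalRealSubfield L)) L (IsCMField.complexConj L) 2).quotFun (eisensteinSeriesU (flatSectionU φ z)) ∧ cc z = bX z) := by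
  -- involution facts and a non-zero trace-zero element of `L` (★ X1)
  have hc : IsCMField.complexConj L * IsCMField.complexConj L = 1 := AlgEquiv.ext fun x => by rw [AlgEquiv.mul_apply, AlgEquiv.one_apply, IsCMField.complexConj_apply_apply]
  have hc1 : IsCMField.complexConj L ≠ 1 := IsCMField.complexConj_ne_one L
  obtain ⟨δ, hcδ, hδ⟩ : ∃ δ : L, IsCMField.complexConj L δ = -δ ∧ δ ≠ 0 := by
    obtain ⟨e, he⟩ : ∃ e : L, IsCMField.complexConj L e ≠ e := by
      by_contra h
      exact hc1 (AlgEquiv.ext fun x => not_ne_iff.mp (not_exists.mp h x))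
    exact ⟨e - IsCMField.complexConj L e, by rw [map_sub, IsCMField.complexConj_apply_apply, neg_sub], sub_ne_zero.2 (Ne.symm he)⟩
  haveI : νG.IsMulRightInvariant := by rw [← Measure.inv_eq_self νG]; infer_instance
  have hright := measurePreserving_rightShift_of_unfolding νG hβ hμZ
  -- the convolution data unpacked
  choose hpos hinj hcl using hι
  choose hs hδι using hpack
  have hfin : μZ {z | a < borelQuotHeight (↥(maximalRealSubfield L)) L (IsCMField.complexConj L) 2 z} ≠ ∞ := measure_setOf_lt_ne_top_cm L μ νG hβ hμZ ha
  haveI : IsFiniteMeasure (weightedTruncMeasure (↥(maximalRealSubfield L)) L (IsCMField.complexConj L) 2 (n + 3) a μZ) := isFiniteMeasure_weightedTruncMeasure_cm L μ νG hβ hμZ ha (n + 3)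
  have hfin₀ : ∀ i, IsFiniteMeasure (weightedTruncMeasure (↥(maximalRealSubfield L)) L (IsCMField.complexConj L) 2 (n + 3) (κ i * a) μZ) := fun i => isFiniteMeasure_weightedTruncMeasure_cm L μ νG hβ hμZ (hpos i) (n + 3)
  -- K2's letter at the system levels `(a, κ_i a)` (★ `hK1_cm_two_of`, `m = 0`), verbatim ★ X1
  letI : MeasurableSpace (AdeleRing (𝓞 L) L) := borel _
  haveI : BorelSpace (AdeleRing (𝓞 L) L) := ⟨rfl⟩
  have hK1i : ∀ i, ∃ m C : ℝ, 0 ≤ m ∧ 0 ≤ C ∧ ∀ f : HNcusp (↥(maximalRealSubfield L)) L (IsCMField.complexConj L) 2 (n + 3) a μZ, ∀ᵐ z ∂(weightedTruncMeasure (↥(maximalRealSubfield L)) L (IsCMField.complexConj L) 2 (n + 3) (κ i * a) μZ),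
      ‖rightConvFun (↥(maximalRealSubfield L)) L (IsCMField.complexConj L) 2 νG ((fun (i : I) (y : (quasiSplit (↥(maximalRealSubfield L)) L (IsCMField.complexConj L) 2).Adelic) => orbitalSmoothing νG (fun x : (quasiSplit (↥(maximalRealSubfield L)) L (IsCMField.complexConj L) 2).Adelic => ((η i (adelicVal (↥(maximalRealSubfield L)) L (IsCMField.complexConj L) 2 ((StdForm.antidiagonal 2).over L) x) : ℝ) : ℂ)) (fun x : (quasiSplit (↥(maximalRealSubfield L)) L (IsCMField.complexConj L) 2).Adelic => ((η i (adelicVal (↥(maximalRealSubfield L)) L (IsCMField.complexConj L) 2 ((StdForm.antidiagonal 2).over L) x) : ℝ) : ℂ)) y) i) ((f : HN (↥(maximalRealSubfield L)) L (IsCMField.complexConj L) 2 (n + 3) a μZ) : borelQuotient (↥(maximalRealSubfield L)) L (IsCMField.complexConj L) 2 → ℂ) z‖ ≤ C * ‖f‖ * ((borelQuotHeight (↥(maximalRealSubfield L)) L (IsCMField.complexConj L) 2 z : ℝ)) ^ (-m) := fun i => by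
    obtain ⟨C₀, hC₀, hh⟩ := K2E1TruncatedCuspDecayHK1CMTwo.hK1_cm_two_of L μZ νG hβ hμZ (hη i) (n + 3) a (κ i * a) (hpos i)
      (fun νN _ _ _ 𝓕N h𝓕 h0 htop f => K2E1TruncatedCuspConstantTermAEU2.ae_borelConstantTerm_indicator_comp_eq_zero_of_mem_HNcusp νG νN
        (fun _ hb₀ => map_conj_toAdelic_eq_self_two hc hc1 νN hb₀) h𝓕 h0 htop hβ hμZ (n + 3) a f)
      (lt_of_lt_of_le zero_lt_one (hκ i).1) le_rfl (hcmp i) (m := 0) le_rfl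
    exact ⟨0, C₀, le_rfl, hC₀, hh⟩
  choose m C hm hC hK1' using hK1i
  -- the constant-term data (★ §2a)
  obtain ⟨hb, α₁, col, eX, hα₁ae, hα₁d, hcolae, -, hLd, hLinj, heXae, hsolC⟩ :=
    exists_chi_constantTerm_data_cm_two L μ νG ν h𝓕N h𝓕c h𝓕₀ hβ hμZ hcδ hδ n ha hφV hφc hφM hli hφ'c hφ'χ hφ'M bX hbX
  -- `L z b = Σ_j b_j • col j z`
  have hLapp : ∀ z (b : ι' → ℂ), (∑ j, (ContinuousLinearMap.proj (R := ℂ) (φ := fun _ : ι' => ℂ) j).smulRight (col j z) : (ι' → ℂ) →L[ℂ] HN (↥(maximalRealSubfield L)) L (IsCMField.complexConj L) 2 (n + 3) a μZ) b = ∑ j, b j • col j z := fun z b => by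
    simp only [FunLike.coe_sum, Finset.sum_apply, ContinuousLinearMap.smulRight_apply, ContinuousLinearMap.proj_apply]
  -- (S1)χ: the eigen-equations `T_i (eX z) = ĥ_i(z) • eX z` from the letter `hS1` (★ row 10, the letter `hS1`, `E(c•f) = c•E(f)`, a.e. transport)
  have hH : ∀ x : (quasiSplit (↥(maximalRealSubfield L)) L (IsCMField.complexConj L) 2).Adelic, (((borelHeight x : ℝ≥0) : ℝ) : ℂ) ≠ 0 := fun x => Complex.ofReal_ne_zero.2 (NNReal.coe_pos.2 (borelHeight_pos x)).ne'
  have hev : ∀ z : ℂ, 1 < z.re → ∀ i (g₀ : (quasiSplit (↥(maximalRealSubfield L)) L (IsCMField.complexConj L) 2).Adelic), (∫ y, (fun (i : I) (y : (quasiSplit (↥(maximalRealSubfield L)) L (IsCMField.complexConj L) 2).Adelic) => orbitalSmoothing νG (fun x : (quasiSplit (↥(maximalRealSubfield L)) L (IsCMField.complexConj L) 2).Adelic => ((η i (adelicVal (↥(maximalRealSubfield L)) L (IsCMField.complexConj L) 2 ((StdForm.antidiagonal 2).over L) x) : ℝ) : ℂ)) (fun x : (quasiSplit (↥(maximalRealSubfield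 L)) L (IsCMField.complexConj L) 2).Adelic => ((η i (adelicVal (↥(maximalRealSubfield L)) L (IsCMField.complexConj L) 2 ((StdForm.antidiagonal 2).over L) x) : ℝ) : ℂ)) y) i y * eisensteinSeriesU (flatSectionU φ z) (g₀ * y) ∂νG) = (∫ x, (fun (i : I) (y : (quasiSplit (↥(maximalRealSubfield L)) L (IsCMField.complexConj L) 2).Adelic) => orbitalSmoothing νG (fun x : (quasiSplit (↥(maximalRealSubfield L)) L (IsCMField.complexConj L) 2).Adelic => ((η i (adelicVal (↥(maximalRealSubfield L)) L (IsCMField.complexConj L) 2 ((StdForm.antidiagonal 2).over L) x) : ℝ) : ℂ)) (fun x : (quasiSplit (↥(maximalRealSubfield L)) L (IsCMField.complexConj L) 2).Adelic => ((η i (adelicVal (↥(maximalRealSubfield L)) L (IsCMField.complexConj L) 2 ((StdForm.antidiagonal 2).over L) x) : ℝ) : ℂ)) y) i x * (((borelHeight x : ℝ≥0) : ℝ) : ℂ) ^ z ∂νG) * eisensteinSeriesU (flatSectionU φ z) g₀ := by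
    intro z hz1 i g₀
    rw [integral_mul_eisensteinSeriesU_flatSectionU_eq_cm_two L νG (hconv i).1 (hconv i).2.1 hφc hφM hz1 g₀]
    have hinner : flatSectionU (fun x : (quasiSplit (↥(maximalRealSubfield L)) L (IsCMField.complexConj L) 2).Adelic => (∫ y, (fun (i : I) (y : (quasiSplit (↥(maximalRealSubfield L)) L (IsCMField.complexConj L) 2).Adelic) => orbitalSmoothing νG (fun x : (quasiSplit (↥(maximalRealSubfield L)) L (IsCMField.complexConj L) 2).Adelic => ((η i (adelicVal (↥(maximalRealSubfield L)) L (IsCMField.complexConj L) 2 ((StdForm.antidiagonal 2).over L) x) : ℝ) : ℂ)) (fun x : (quasiSplit (↥(maximalRealSubfield L)) L (IsCMField.complexConj L) 2).Adelic => ((η i (adelicVal (↥(maximalRealSubfield L)) L (IsCMField.complexConj L) 2 ((StdForm.antidiagonal 2).over L) x) : ℝ) : ℂ)) y) i y * flatSectionU φ z (x * y) ∂νG) * (((borelHeight x : ℝ≥0) : ℝ) : ℂ) ^ (-z)) z =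
        (∫ x, (fun (i : I) (y : (quasiSplit (↥(maximalRealSubfield L)) L (IsCMField.complexConj L) 2).Adelic) => orbitalSmoothing νG (fun x : (quasiSplit (↥(maximalRealSubfield L)) L (IsCMField.complexConj L) 2).Adelic => ((η i (adelicVal (↥(maximalRealSubfield L)) L (IsCMField.complexConj L) 2 ((StdForm.antidiagonal 2).over L) x) : ℝ) : ℂ)) (fun x : (quasiSplit (↥(maximalRealSubfield L)) L (IsCMField.complexConj L) 2).Adelic => ((η i (adelicVal (↥(maximalRealSubfield L)) L (IsCMField.complexConj L) 2 ((StdForm.antidiagonal 2).over L) x) : ℝ) : ℂ)) y) i x * (((borelHeight x : ℝ≥0) : ℝ) : ℂ) ^ z ∂νG) • flatSectionU φ z := by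
      funext g
      rw [flatSectionU_apply, hS1 i z hz1 g, Pi.smul_apply, smul_eq_mul, mul_assoc, mul_assoc, ← Complex.cpow_add _ _ (hH g), neg_add_cancel, Complex.cpow_zero, mul_one]
    rw [hinner, eisensteinSeriesU_smul]
  have hsolT : ∀ z ∈ Metric.ball (0 : ℂ) (n + 2), (1 : ℝ) < z.re → ∀ i, T i (eX z) = (∫ x, (fun (i : I) (y : (quasiSplit (↥(maximalRealSubfield L)) L (IsCMField.complexConj L) 2).Adelic) => orbitalSmoothing νG (fun x : (quasiSplit (↥(maximalRealSubfield L)) L (IsCMField.complexConj L) 2).Adelic => ((η i (adelicVal (↥(maximalRealSubfield L)) L (IsCMField.complexConj L) 2 ((StdForm.antidiagonal 2).over L) x) : ℝ) : ℂ)) (fun x : (quasiSplit (↥(maximalRealSubfield L)) L (IsCMField.complexConj L) 2).Adelic => ((η i (adelicVal (↥(maximalRealSubfield L)) L (IsCMField.complexConj L) 2 ((StdForm.antidiagonal 2).over L) x) : ℝ) : ℂ)) y) i x * (((borelHeight x : ℝ≥0) : ℝ) : ℂ) ^ z ∂νG) • eX z := by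
    intro z hz hz1 i
    have hψ := (heXae z hz hz1)
    have hφG := eisensteinSeriesU_flatSectionU_quotientSubgroup_mul_of_isChiSection L hφV.1 z
    have hevq : ∀ ξ : (quasiSplit (↥(maximalRealSubfield L)) L (IsCMField.complexConj L) 2).automorphicQuotient, (∫ y, (fun (i : I) (y : (quasiSplit (↥(maximalRealSubfield L)) L (IsCMField.complexConj L) 2).Adelic) => orbitalSmoothing νG (fun x : (quasiSplit (↥(maximalRealSubfield L)) L (IsCMField.complexConj L) 2).Adelic => ((η i (adelicVal (↥(maximalRealSubfield L)) L (IsCMField.complexConj L) 2 ((StdForm.antidiagonal 2).over L) x) : ℝ) : ℂ)) (fun x : (quasiSplit (↥(maximalRealSubfield L)) L (IsCMField.complexConj L) 2).Adelic => ((η i (adelicVal (↥(maximalRealSubfield L)) L (IsCMField.complexConj L) 2 ((StdForm.antidiagonal 2).over L) x) : ℝ) : ℂ)) y) i y * (quasiSplit (↥(maximalRealSubfield L)) L (IsCMField.complexConj L) 2).quotFun (eisensteinSeriesU (flatSectionU φ z)) (y⁻¹ • ξ) ∂νG) =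
        (∫ x, (fun (i : I) (y : (quasiSplit (↥(maximalRealSubfield L)) L (IsCMField.complexConj L) 2).Adelic) => orbitalSmoothing νG (fun x : (quasiSplit (↥(maximalRealSubfield L)) L (IsCMField.complexConj L) 2).Adelic => ((η i (adelicVal (↥(maximalRealSubfield L)) L (IsCMField.complexConj L) 2 ((StdForm.antidiagonal 2).over L) x) : ℝ) : ℂ)) (fun x : (quasiSplit (↥(maximalRealSubfield L)) L (IsCMField.complexConj L) 2).Adelic => ((η i (adelicVal (↥(maximalRealSubfield L)) L (IsCMField.complexConj L) 2 ((StdForm.antidiagonal 2).over L) x) : ℝ) : ℂ)) y) i x * (((borelHeight x : ℝ≥0) : ℝ) : ℂ) ^ z ∂νG) * (quasiSplit (↥(maximalRealSubfield L)) L (IsCMField.complexConj L) 2).quotFun (eisensteinSeriesU (flatSectionU φ z)) ξ := by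
      intro ξ
      obtain ⟨g₀, rfl⟩ := QuotientGroup.mk_surjective ξ
      change (∫ y, (fun (i : I) (y : (quasiSplit (↥(maximalRealSubfield L)) L (IsCMField.complexConj L) 2).Adelic) => orbitalSmoothing νG (fun x : (quasiSplit (↥(maximalRealSubfield L)) L (IsCMField.complexConj L) 2).Adelic => ((η i (adelicVal (↥(maximalRealSubfield L)) L (IsCMField.complexConj L) 2 ((StdForm.antidiagonal 2).over L) x) : ℝ) : ℂ)) (fun x : (quasiSplit (↥(maximalRealSubfield L)) L (IsCMField.complexConj L) 2).Adelic => ((η i (adelicVal (↥(maximalRealSubfield L)) L (IsCMField.complexConj L) 2 ((StdForm.antidiagonal 2).over L) x) : ℝ) : ℂ)) y) i y * (quasiSplit (↥(maximalRealSubfield L)) L (IsCMField.complexConj L) 2).quotFun (eisensteinSeriesU (flatSectionU φ z)) (y⁻¹ • (quasiSplit (↥(maximalRealSubfield L)) L (IsCMField.complexConj L) 2).toAutomorphicQuotient g₀) ∂νG) =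
        (∫ x, (fun (i : I) (y : (quasiSplit (↥(maximalRealSubfield L)) L (IsCMField.complexConj L) 2).Adelic) => orbitalSmoothing νG (fun x : (quasiSplit (↥(maximalRealSubfield L)) L (IsCMField.complexConj L) 2).Adelic => ((η i (adelicVal (↥(maximalRealSubfield L)) L (IsCMField.complexConj L) 2 ((StdForm.antidiagonal 2).over L) x) : ℝ) : ℂ)) (fun x : (quasiSplit (↥(maximalRealSubfield L)) L (IsCMField.complexConj L) 2).Adelic => ((η i (adelicVal (↥(maximalRealSubfield L)) L (IsCMField.complexConj L) 2 ((StdForm.antidiagonal 2).over L) x) : ℝ) : ℂ)) y) i x * (((borelHeight x : ℝ≥0) : ℝ) : ℂ) ^ z ∂νG) * (quasiSplit (↥(maximalRealSubfield L)) L (IsCMField.complexConj L) 2).quotFun (eisensteinSeriesU (flatSectionU φ z)) ((quasiSplit (↥(maximalRealSubfield L)) L (IsCMField.complexConj L) 2).toAutomorphicQuotient g₀)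
      simp only [quotFun_inv_smul_toAutomorphicQuotient L hφG, AdelicGroupData.quotFun_toAutomorphicQuotient hφG]
      simpa only using hev z hz1 i g₀⁻¹
    have h2 := convX_congr_ae νG μ ((fun (i : I) (y : (quasiSplit (↥(maximalRealSubfield L)) L (IsCMField.complexConj L) 2).Adelic) => orbitalSmoothing νG (fun x : (quasiSplit (↥(maximalRealSubfield L)) L (IsCMField.complexConj L) 2).Adelic => ((η i (adelicVal (↥(maximalRealSubfield L)) L (IsCMField.complexConj L) 2 ((StdForm.antidiagonal 2).over L) x) : ℝ) : ℂ)) (fun x : (quasiSplit (↥(maximalRealSubfield L)) L (IsCMField.complexConj L) 2).Adelic => ((η i (adelicVal (↥(maximalRealSubfield L)) L (IsCMField.complexConj L) 2 ((StdForm.antidiagonal 2).over L) x) : ℝ) : ℂ)) y) i) ((ae_withDensity_weightX_iff μ (n + 3)).1 hψ)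
    refine Lp.ext ((hT i _).trans (EventuallyEq.trans ?_ (Lp.coeFn_smul _ _).symm))
    refine (ae_withDensity_weightX_iff μ (n + 3)).2 ?_
    filter_upwards [h2, (ae_withDensity_weightX_iff μ (n + 3)).1 hψ] with ξ hξ hψξ
    rw [hξ, hevq ξ, Pi.smul_apply, smul_eq_mul, hψξ]
  have hsolQ : ∀ z ∈ Metric.ball (0 : ℂ) (n + 2), (1 : ℝ) < z.re → (0 : HX (↥(maximalRealSubfield L)) L (IsCMField.complexConj L) 2 (n + 3) μ →L[ℂ] HX (↥(maximalRealSubfield L)) L (IsCMField.complexConj L) 2 (n + 3) μ) (eX z) = 0 := fun _ _ _ => rfl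
  have hsolC' : ∀ z ∈ Metric.ball (0 : ℂ) (n + 2), (1 : ℝ) < z.re → cnstN (↥(maximalRealSubfield L)) L (IsCMField.complexConj L) 2 (n + 3) a μZ (iota hb (eX z)) = (1 : ℂ) • α₁ z + (fun w => (∑ j, (ContinuousLinearMap.proj (R := ℂ) (φ := fun _ : ι' => ℂ) j).smulRight (col j w) : (ι' → ℂ) →L[ℂ] HN (↥(maximalRealSubfield L)) L (IsCMField.complexConj L) 2 (n + 3) a μZ)) z (bX z) :=
    fun z hz hz1 => hsolC z hz hz1
  have hLinj' : ∀ z ∈ Metric.ball (0 : ℂ) (n + 2), (1 : ℝ) < z.re → Function.Injective ((fun w => (∑ j, (ContinuousLinearMap.proj (R := ℂ) (φ := fun _ : ι' => ℂ) j).smulRight (col j w) : (ι' → ℂ) →L[ℂ] HN (↥(maximalRealSubfield L)) L (IsCMField.complexConj L) 2 (n + 3) a μZ)) z) := fun z hz hz1 => hLinj z hz hz1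
  -- `hδL`: `δ(L z b)` essentially bounded at the level `κ i₀ * a` (columns a.e. `zFun φ′_j · HZ^(1−z)`, ★ payer, finite sums)
  have hδL : ∀ z ∈ Metric.ball (0 : ℂ) (n + 2), 1 < z.re → ∀ b' : ι' → ℂ, ∃ M : ℝ, ∀ᵐ x ∂(weightedTruncMeasure (↥(maximalRealSubfield L)) L (IsCMField.complexConj L) 2 (n + 3) (κ i₀ * a) μZ),
      ‖(deltaShift (hs i₀) ((fun w => (∑ j, (ContinuousLinearMap.proj (R := ℂ) (φ := fun _ : ι' => ℂ) j).smulRight (col j w) : (ι' → ℂ) →L[ℂ] HN (↥(maximalRealSubfield L)) L (IsCMField.complexConj L) 2 (n + 3) a μZ)) z b') : borelQuotient (↥(maximalRealSubfield L)) L (IsCMField.complexConj L) 2 → ℂ) x‖ ≤ M := by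
    intro z hz hz1 b'
    have hcolj : ∀ j, ∃ Mj : ℝ, ∀ᵐ x ∂(weightedTruncMeasure (↥(maximalRealSubfield L)) L (IsCMField.complexConj L) 2 (n + 3) (κ i₀ * a) μZ), ‖(deltaShift (hs i₀) (col j z) : borelQuotient (↥(maximalRealSubfield L)) L (IsCMField.complexConj L) 2 → ℂ) x‖ ≤ Mj := fun j =>
      exists_ae_norm_deltaShift_le_of_ae_eq_mul_cpow hright (isClosed_tsupport _).measurableSet (lt_of_lt_of_le zero_lt_one (hκ i₀).1) le_rfl (hcmp i₀)
        (fun y hy => image_eq_zero_of_notMem_tsupport hy) ((hconv i₀).1.integrable_of_hasCompactSupport (hconv i₀).2.1) (hs i₀) ha (norm_zFun_le (hφ'M j))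
        (by rw [← zFun_flatSectionU]; exact hcolae j z hz) (by rw [Complex.sub_re, Complex.one_re]; linarith)
    choose Mj hMj using hcolj
    refine ⟨∑ j, ‖b' j‖ * Mj j, ?_⟩
    have hsum : deltaShift (hs i₀) ((fun w => (∑ j, (ContinuousLinearMap.proj (R := ℂ) (φ := fun _ : ι' => ℂ) j).smulRight (col j w) : (ι' → ℂ) →L[ℂ] HN (↥(maximalRealSubfield L)) L (IsCMField.complexConj L) 2 (n + 3) a μZ)) z b') = ∑ j, b' j • deltaShift (hs i₀) (col j z) := by
      rw [show (fun w => (∑ j, (ContinuousLinearMap.proj (R := ℂ) (φ := fun _ : ι' => ℂ) j).smulRight (col j w) : (ι' → ℂ) →L[ℂ] HN (↥(maximalRealSubfield L)) L (IsCMField.complexConj L) 2 (n + 3) a μZ)) z b' = ∑ j, b' j • col j z from hLapp z b', _root_.map_sum]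
      simp only [map_smul]
    rw [hsum]
    filter_upwards [coeFn_sum_smul_ae_eq Finset.univ b' (fun j => deltaShift (hs i₀) (col j z)), ae_all_iff.2 hMj] with x hx hbd
    rw [hx]
    exact (norm_sum_le _ _).trans (Finset.sum_le_sum fun j _ => by rw [norm_mul]; exact mul_le_mul_of_nonneg_left (hbd j) (norm_nonneg _))
  -- uniqueness on an open non-empty part of the Godement set (★ `hunq_chi_cm_two`, `Q := 0`)
  have hunq := hunq_chi_cm_two L μ νG hβ hμZ (n + 3) n i₀ (h := (fun (i : I) (y : (quasiSplit (↥(maximalRealSubfield L)) L (IsCMField.complexConj L) 2).Adelic) => orbitalSmoothing νG (fun x : (quasiSplit (↥(maximalRealSubfield L)) L (IsCMField.complexConj L) 2).Adelic => ((η i (adelicVal (↥(maximalRealSubfield L)) L (IsCMField.complexConj L) 2 ((StdForm.antidiagonal 2).over L) x) : ℝ) : ℂ)) (fun x : (quasiSplit (↥(maximalRealSubfield L)) L (IsCMField.complexConj L) 2).Adelic => ((η i (adelicVal (↥(maximalRealSubfield L)) L (IsCMField.complexConj L) 2 ((StdForm.antidiagonal 2).over L) x) : ℝ) : ℂ)) y))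 (fun i => (hconv i).1) (fun i => (hconv i).2.1) (hconv i₀).2.2.1 (hconv i₀).2.2.2.1 (hconv i₀).2.2.2.2
    hh1 (hpos i₀) (hκ i₀).2 hfin hb (hs i₀) T (hT i₀) (hδι i₀ (hκ i₀).2) (hC i₀) (hm i₀) (hK1' i₀) α₁ (fun w => (∑ j, (ContinuousLinearMap.proj (R := ℂ) (φ := fun _ : ι' => ℂ) j).smulRight (col j w) : (ι' → ℂ) →L[ℂ] HN (↥(maximalRealSubfield L)) L (IsCMField.complexConj L) 2 (n + 3) a μZ)) hδL
    (0 : HX (↥(maximalRealSubfield L)) L (IsCMField.complexConj L) 2 (n + 3) μ →L[ℂ] HX (↥(maximalRealSubfield L)) L (IsCMField.complexConj L) 2 (n + 3) μ) 1 eX bX hsolT hsolC' hsolQ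
  -- the by-products of the 𝔛-system on the ball (★ X1_χ ED. 2, `σ₀ = 1`)
  obtain ⟨U, vX, cc, hUo, hUD, hDcl, hUcd, hvXd, hvXm, hccd, hccm, heqs, hunqU, hagree, -⟩ :=
    exists_chi_xSystem_byproducts' 1 n (n + 3) νG ha (a₀ := fun i => κ i * a) (fun i => (hκ i).2) (hfin₀ := hfin₀) hb
      (fun i => iotaBound_cm L μ νG hβ hμZ (hpos i) (n + 3)) hcl hinj (fun (i : I) (y : (quasiSplit (↥(maximalRealSubfield L)) L (IsCMField.complexConj L) 2).Adelic) => orbitalSmoothing νG (fun x : (quasiSplit (↥(maximalRealSubfield L)) L (IsCMField.complexConj L) 2).Adelic => ((η i (adelicVal (↥(maximalRealSubfield L)) L (IsCMField.complexConj L) 2 ((StdForm.antidiagonal 2).over L) x) : ℝ) : ℂ)) (fun x : (quasiSplit (↥(maximalRealSubfield L)) L (IsCMField.complexConj L) 2).Adelic => ((η i (adelicVal (↥(maximalRealSubfield L)) L (IsCMField.complexConj L) 2 ((StdForm.antidiagonal 2).over L) x) : ℝ) : ℂ)) y) (fun i => (hconv i).1) (fun i => (hconv i).2.1) hcov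
      hs hm hC hK1' T (fun i => hδι i (hκ i).2) hα₁d (L := fun w => (∑ j, (ContinuousLinearMap.proj (R := ℂ) (φ := fun _ : ι' => ℂ) j).smulRight (col j w) : (ι' → ℂ) →L[ℂ] HN (↥(maximalRealSubfield L)) L (IsCMField.complexConj L) 2 (n + 3) a μZ)) hLd hLinj' (0 : HX (↥(maximalRealSubfield L)) L (IsCMField.complexConj L) 2 (n + 3) μ →L[ℂ] HX (↥(maximalRealSubfield L)) L (IsCMField.complexConj L) 2 (n + 3) μ) 1 eX bX hsolT hsolC' hsolQ hunq
  refine ⟨U, vX, cc, hb, α₁, col, hUo, hUD, hDcl, hUcd, hvXd, hvXm, hccd, hccm, hα₁ae, hcolae, fun z hz => ⟨(heqs z hz).1, (heqs z hz).2.1⟩,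
    fun z hz ψ b hψ hC' => hunqU z hz ψ b hψ hC' rfl, fun z hz hz1 => ⟨?_, (hagree z hz hz1).2⟩⟩
  rw [(hagree z hz hz1).1]
  exact heXae z (hUD hz) hz1

end Summit.HodgeConjecture.HodgeConjecture.Cruxes.H413.K2E1ChiEisensteinBallPackageCMTwo

end
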